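import Mathlib.Tactic.Ring
import Mathlib.Tactic.Linarith
import Mathlib.Tactic.Positivity
import Mathlib.Tactic.LinearCombination
import Mathlib.Data.Real.Basic
import HarnessLib

/-!
# Conjecture N (hodge-weil ladder, GAPS G51b), format (4,2): three inequalities for the five-root cluster

Prover 2, generation 11 (note `run/shared/lean/b2b/hodge-weil/b2b-hweil-pv2-g11/CROSS-MAX-G11.md` §3.6 and ADDENDUM 1). Companion of
`WeilClassTestEscapeDirections.lean` (same seat): there (`clusterForm_pure`) the charge-zero class-test quantity `G₀` of a pure (4,2)
configuration is rewritten, after splitting off one E-root, as `S_ζ·G₀ = 4S_{yζ²}² + 4u₁²(S_yS_ζ − 4S_{yζ}² − 6S_ζ²) + S_ζ·K` with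
`K = ½S_yS_ζ + S_{yζ}² − 3S_{y²ζ²} + 3S_{ζ⁴} − (3/2)S_ζ²` — and `K = Q₂(C) + Q₄(C)` is the SAME functional evaluated on the remaining
five-root CLUSTER `C` (three E-roots, two F-roots; positions `y` and charges `ζ` centred in the signed sense). This file proves three
sign facts about such clusters that need only DOMINANCE (every E-root above every F-root) and the two centrings — written in 'frame'
coordinates: the top F-root at `−T`, the other F-root at `−T − g` (`g ≥ 0`), the E-roots at `−T + δ_e` (`δ_e ≥ 0`), where position
centring forces `T = δ₁ + δ₂ + δ₃ + g`; charges `α_e` (E), `β₁, β₂` (F) with `β₂ = α₁ + α₂ + α₃ − β₁`: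
(1) `S_y = Σ_E y² − Σ_F y² = −2(δ₁δ₂ + δ₁δ₃ + δ₂δ₃ + g(δ₁+δ₂+δ₃) + g²) ≤ 0`;
(2) `S_{yζ²} = Σ_E yα² − Σ_F yβ² = Σδ_eα_e² + gβ₂² + T·(β₁² + β₂² − Σα²)`, hence `≥ 0` whenever `S_ζ = Σα² − β₁² − β₂² ≤ 0`;
(3) `Q₂(C) = ½S_yS_ζ + S_{yζ}² − 3S_{y²ζ²} = (Σδ_eα_e + gβ₂)² + 3Σδ_e(2T − δ_e)α_e² + 3g(g + 2T)β₂² + ½(β₁²+β₂²−Σα²)(7T² − Σδ² + g²)`,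
hence `Q₂(C) ≥ 0` whenever `S_ζ ≤ 0` (the g8 frame identity for a mass-one signed configuration; no ampleness needed).
With these, in the cluster form for an E-root with `S_ζ < 0` every piece except `4S_{yζ²}²` has a definite sign. Pure algebra plus
`positivity`; nothing here is a rung, a door edge or a cited fact; no statement of Markman's papers is used. New cell result ⇒ Summits/.
-/

set_option linter.dupNamespace false

namespace Summit.HodgeConjecture.HodgeConjecture.WeilClassTestClusterLemmas

/-- (1) For a centred dominant (3,2) cluster the signed second position moment is non-positive:
`S_y = −2(δ₁δ₂ + δ₁δ₃ + δ₂δ₃ + g(δ₁+δ₂+δ₃) + g²)` (identity), `≤ 0` for `δ_e, g ≥ 0`. -/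
theorem cluster_Sy_nonpos (δ₁ δ₂ δ₃ g : ℝ) (h₁ : 0 ≤ δ₁) (h₂ : 0 ≤ δ₂) (h₃ : 0 ≤ δ₃) (hg : 0 ≤ g) :
    let T : ℝ := δ₁ + δ₂ + δ₃ + g
    (δ₁ - T) ^ 2 + (δ₂ - T) ^ 2 + (δ₃ - T) ^ 2 - ((-T) ^ 2 + (-T - g) ^ 2)
      = -2 * (δ₁ * δ₂ + δ₁ * δ₃ + δ₂ * δ₃ + g * (δ₁ + δ₂ + δ₃) + g ^ 2)
    ∧ (δ₁ - T) ^ 2 + (δ₂ - T) ^ 2 + (δ₃ - T) ^ 2 - ((-T) ^ 2 + (-T - g) ^ 2) ≤ 0 := by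
  intro T
  have hid : (δ₁ - T) ^ 2 + (δ₂ - T) ^ 2 + (δ₃ - T) ^ 2 - ((-T) ^ 2 + (-T - g) ^ 2)
      = -2 * (δ₁ * δ₂ + δ₁ * δ₃ + δ₂ * δ₃ + g * (δ₁ + δ₂ + δ₃) + g ^ 2) := by
    simp only [T]; ring
  refine ⟨hid, ?_⟩
  rw [hid]
  have : 0 ≤ δ₁ * δ₂ + δ₁ * δ₃ + δ₂ * δ₃ + g * (δ₁ + δ₂ + δ₃) + g ^ 2 := by positivity
  linarith

/-- (2) `S_{yζ²} = Σδ_eα_e² + gβ₂² + T·(β₁² + β₂² − Σα²)` (identity; charge centring is not needed here), hence `S_{yζ²} ≥ 0`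
when `S_ζ = Σα² − β₁² − β₂² ≤ 0`. -/
theorem cluster_Syz2_nonneg (δ₁ δ₂ δ₃ g α₁ α₂ α₃ β₁ β₂ : ℝ) (h₁ : 0 ≤ δ₁) (h₂ : 0 ≤ δ₂) (h₃ : 0 ≤ δ₃) (hg : 0 ≤ g)
    (hS : α₁ ^ 2 + α₂ ^ 2 + α₃ ^ 2 ≤ β₁ ^ 2 + β₂ ^ 2) :
    let T : ℝ := δ₁ + δ₂ + δ₃ + g
    (δ₁ - T) * α₁ ^ 2 + (δ₂ - T) * α₂ ^ 2 + (δ₃ - T) * α₃ ^ 2 - ((-T) * β₁ ^ 2 + (-T - g) * β₂ ^ 2)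
      = δ₁ * α₁ ^ 2 + δ₂ * α₂ ^ 2 + δ₃ * α₃ ^ 2 + g * β₂ ^ 2 + T * (β₁ ^ 2 + β₂ ^ 2 - (α₁ ^ 2 + α₂ ^ 2 + α₃ ^ 2))
    ∧ 0 ≤ (δ₁ - T) * α₁ ^ 2 + (δ₂ - T) * α₂ ^ 2 + (δ₃ - T) * α₃ ^ 2 - ((-T) * β₁ ^ 2 + (-T - g) * β₂ ^ 2) := by
  intro T
  have hid : (δ₁ - T) * α₁ ^ 2 + (δ₂ - T) * α₂ ^ 2 + (δ₃ - T) * α₃ ^ 2 - ((-T) * β₁ ^ 2 + (-T - g) * β₂ ^ 2)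
      = δ₁ * α₁ ^ 2 + δ₂ * α₂ ^ 2 + δ₃ * α₃ ^ 2 + g * β₂ ^ 2 + T * (β₁ ^ 2 + β₂ ^ 2 - (α₁ ^ 2 + α₂ ^ 2 + α₃ ^ 2)) := by
    ring
  refine ⟨hid, ?_⟩
  rw [hid]
  have hT : 0 ≤ T := by simp only [T]; positivity
  have hD : 0 ≤ β₁ ^ 2 + β₂ ^ 2 - (α₁ ^ 2 + α₂ ^ 2 + α₃ ^ 2) := by linarith
  have : 0 ≤ T * (β₁ ^ 2 + β₂ ^ 2 - (α₁ ^ 2 + α₂ ^ 2 + α₃ ^ 2)) := mul_nonneg hT hD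
  positivity

/-- (3) THE FRAME FORM OF `Q₂` FOR A MASS-ONE CLUSTER (identity; charge centring `β₂ = α₁+α₂+α₃−β₁` substituted):
`Q₂(C) = (Σδ_eα_e + gβ₂)² + 3Σδ_e(2T − δ_e)α_e² + 3g(g + 2T)β₂² + ½(β₁² + β₂² − Σα²)(7T² − (δ₁²+δ₂²+δ₃²) + g²)`. -/
theorem cluster_Q2_frame_identity (δ₁ δ₂ δ₃ g α₁ α₂ α₃ β₁ : ℝ) :
    let T : ℝ := δ₁ + δ₂ + δ₃ + g
    let β₂ : ℝ := α₁ + α₂ + α₃ - β₁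
    let Sy : ℝ := (δ₁ - T) ^ 2 + (δ₂ - T) ^ 2 + (δ₃ - T) ^ 2 - ((-T) ^ 2 + (-T - g) ^ 2)
    let Sz : ℝ := α₁ ^ 2 + α₂ ^ 2 + α₃ ^ 2 - (β₁ ^ 2 + β₂ ^ 2)
    let Syz : ℝ := (δ₁ - T) * α₁ + (δ₂ - T) * α₂ + (δ₃ - T) * α₃ - ((-T) * β₁ + (-T - g) * β₂)
    let Sy2z2 : ℝ := (δ₁ - T) ^ 2 * α₁ ^ 2 + (δ₂ - T) ^ 2 * α₂ ^ 2 + (δ₃ - T) ^ 2 * α₃ ^ 2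
      - ((-T) ^ 2 * β₁ ^ 2 + (-T - g) ^ 2 * β₂ ^ 2)
    1 / 2 * Sy * Sz + Syz ^ 2 - 3 * Sy2z2
      = (δ₁ * α₁ + δ₂ * α₂ + δ₃ * α₃ + g * β₂) ^ 2
        + 3 * (δ₁ * (2 * T - δ₁) * α₁ ^ 2 + δ₂ * (2 * T - δ₂) * α₂ ^ 2 + δ₃ * (2 * T - δ₃) * α₃ ^ 2)
        + 3 * g * (g + 2 * T) * β₂ ^ 2
        + 1 / 2 * (β₁ ^ 2 + β₂ ^ 2 - (α₁ ^ 2 + α₂ ^ 2 + α₃ ^ 2)) * (7 * T ^ 2 - (δ₁ ^ 2 + δ₂ ^ 2 + δ₃ ^ 2) + g ^ 2) := by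
  intro T β₂ Sy Sz Syz Sy2z2
  simp only [Sy, Sz, Syz, Sy2z2, β₂, T]
  ring

/-- (3') `Q₂(C) ≥ 0` for a centred dominant (3,2) cluster with `S_ζ ≤ 0` (no ampleness needed): every term of the frame form is
non-negative, since `0 ≤ δ_e ≤ T`, `g ≥ 0`, and `7T² − Σδ² + g² = 6T² + 2(δ₁δ₂+δ₁δ₃+δ₂δ₃) + 2g(δ₁+δ₂+δ₃) + 2g² ≥ 0`. -/
theorem cluster_Q2_nonneg (δ₁ δ₂ δ₃ g α₁ α₂ α₃ β₁ : ℝ) (h₁ : 0 ≤ δ₁) (h₂ : 0 ≤ δ₂) (h₃ : 0 ≤ δ₃) (hg : 0 ≤ g)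
    (hS : α₁ ^ 2 + α₂ ^ 2 + α₃ ^ 2 ≤ β₁ ^ 2 + (α₁ + α₂ + α₃ - β₁) ^ 2) :
    let T : ℝ := δ₁ + δ₂ + δ₃ + g
    let β₂ : ℝ := α₁ + α₂ + α₃ - β₁
    let Sy : ℝ := (δ₁ - T) ^ 2 + (δ₂ - T) ^ 2 + (δ₃ - T) ^ 2 - ((-T) ^ 2 + (-T - g) ^ 2)
    let Sz : ℝ := α₁ ^ 2 + α₂ ^ 2 + α₃ ^ 2 - (β₁ ^ 2 + β₂ ^ 2)
    let Syz : ℝ := (δ₁ - T) * α₁ + (δ₂ - T) * α₂ + (δ₃ - T) * α₃ - ((-T) * β₁ + (-T - g) * β₂)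
    let Sy2z2 : ℝ := (δ₁ - T) ^ 2 * α₁ ^ 2 + (δ₂ - T) ^ 2 * α₂ ^ 2 + (δ₃ - T) ^ 2 * α₃ ^ 2
      - ((-T) ^ 2 * β₁ ^ 2 + (-T - g) ^ 2 * β₂ ^ 2)
    0 ≤ 1 / 2 * Sy * Sz + Syz ^ 2 - 3 * Sy2z2 := by
  intro T β₂ Sy Sz Syz Sy2z2
  have hid := cluster_Q2_frame_identity δ₁ δ₂ δ₃ g α₁ α₂ α₃ β₁
  simp only at hid
  simp only [Sy, Sz, Syz, Sy2z2, β₂, T]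
  rw [hid]
  have hT1 : 0 ≤ 2 * (δ₁ + δ₂ + δ₃ + g) - δ₁ := by linarith
  have hT2 : 0 ≤ 2 * (δ₁ + δ₂ + δ₃ + g) - δ₂ := by linarith
  have hT3 : 0 ≤ 2 * (δ₁ + δ₂ + δ₃ + g) - δ₃ := by linarith
  have h7 : 7 * (δ₁ + δ₂ + δ₃ + g) ^ 2 - (δ₁ ^ 2 + δ₂ ^ 2 + δ₃ ^ 2) + g ^ 2
      = 6 * (δ₁ + δ₂ + δ₃ + g) ^ 2 + 2 * (δ₁ * δ₂ + δ₁ * δ₃ + δ₂ * δ₃) + 2 * g * (δ₁ + δ₂ + δ₃) + 2 * g ^ 2 := by ring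
  have h7' : 0 ≤ 7 * (δ₁ + δ₂ + δ₃ + g) ^ 2 - (δ₁ ^ 2 + δ₂ ^ 2 + δ₃ ^ 2) + g ^ 2 := by rw [h7]; positivity
  have hD : 0 ≤ β₁ ^ 2 + (α₁ + α₂ + α₃ - β₁) ^ 2 - (α₁ ^ 2 + α₂ ^ 2 + α₃ ^ 2) := by linarith
  have t1 : 0 ≤ δ₁ * (2 * (δ₁ + δ₂ + δ₃ + g) - δ₁) * α₁ ^ 2 := by positivity
  have t2 : 0 ≤ δ₂ * (2 * (δ₁ + δ₂ + δ₃ + g) - δ₂) * α₂ ^ 2 := by positivity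
  have t3 : 0 ≤ δ₃ * (2 * (δ₁ + δ₂ + δ₃ + g) - δ₃) * α₃ ^ 2 := by positivity
  have t4 : 0 ≤ 3 * g * (g + 2 * (δ₁ + δ₂ + δ₃ + g)) * (α₁ + α₂ + α₃ - β₁) ^ 2 := by positivity
  have t5 : 0 ≤ 1 / 2 * (β₁ ^ 2 + (α₁ + α₂ + α₃ - β₁) ^ 2 - (α₁ ^ 2 + α₂ ^ 2 + α₃ ^ 2))
      * (7 * (δ₁ + δ₂ + δ₃ + g) ^ 2 - (δ₁ ^ 2 + δ₂ ^ 2 + δ₃ ^ 2) + g ^ 2) := by positivity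
  have t0 : 0 ≤ (δ₁ * α₁ + δ₂ * α₂ + δ₃ * α₃ + g * (α₁ + α₂ + α₃ - β₁)) ^ 2 := by positivity
  linarith

end Summit.HodgeConjecture.HodgeConjecture.WeilClassTestClusterLemmas
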